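import Literature.MathematicalPhysics.QuantumFieldTheory.Balaban1983to89.B8LeafKnitRS
import Literature.MathematicalPhysics.QuantumFieldTheory.Balaban1983to89.B8LeafModelZd3Thm2

/-!
# `Balaban1983to89.B8LeafKnitZd3` — [Balaban1985RegularSpaces] THE RE-TYPED B8 LEAF `B8LeafKnitRS.B8LeafRS` (Lemma 1 p. 79 – Theorem 8
# p. 101) AT THE CONCRETE GENERAL-BACKGROUND FAMILY OF RECORD CANDIDATE — the `Ω₀ = ℤᵈ` sub-family of `B8LeafModelZd3.zdGF3` for
# `X.fam8R` and the non-abelian block-pair carriers for Lemma 1 —: FOUR of the nine conjuncts DISCHARGED BY KERNEL INSTANCES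
# (`l1`, `t2`, `p3`, `t4`) modulo NAMED SOCKETS, the five others (`p5e p5u p6 p7 t8`) remaining as named hypotheses

statement-level skeleton of published theorems with citation tags; proofs where landed; nothing here is a claim about the
Yang–Mills mass gap

PDF held: `paper:balaban1985-cmp99-regular-spaces-gauge-fixing` (journal page = PDF page + 74); pp. 79–101.

WHY THIS FILE (cell `pub-ymgap`, HUMAN RULING D-0062, seat `pub-ymgap-dag-n05-a` g5 = the KNIT-BY-NAME seat of DAG node N05 = [B8];
count-neutral).  The node's statement of record is `Dag.B8_main (DagBinding.leavesP w P)` ↔ the leaf `B8LeafRS … X.fam8R X.lan8 X.cub8 …`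
of the B8 family of record (`B8LeafKnitRS.b8_main_iff_of_upS`), which NODE 00 has not pinned yet (N0-6).  The previous knits
(`B8LeafKnit.b8LeafR_knit`, `B8LeafKnitRS.b8LeafRS_knit(_blockPairNA)`) take ALL printed statements as hypotheses over ABSTRACT families
(and derive `t2` by a carrier law `h137` that honest carriers do not satisfy).  THIS knit is at a CONCRETE family: `fam := fun i : {i :
ZdIdx d L // i.Ω 0 = univ} => zdGF3 𝔸 L β len i.1` (the `GFData3` prototype of the seat's g5 design note, on the sub-index where
Theorems 2/8 are not refuted — `B8LeafModelZd3Boundary`), `loc := B8Lemma1NonAbelian.blockPairNA d Lb 𝔸`.  On it `l1` is lit's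
`B8Lemma1NonAbelian.lemma1Printed_blockPairNA` (hypothesis-free), `t4` is `B8LeafModelZd3.thm4Printed_zd3_of_HFP₄`, `p3` is
`B8LeafModelZd3.prop3Printed_zd3`, `t2` is `B8LeafModelZd3Thm2.thm2Printed_zd3_univ` — each modulo the member-wise SOCKETS `SockHFP₀` /
`SockHFP` (Proposition 5's fixed point in plain currency — provider skeleton `B8Prop5JoinHFP`, JOIN-C in progress), `SockP5u` ((1.109)),
`SockH59` / `SockB9P3` ([4] Theorem 3.3 = in-edge b9, in Theorem 4's and Proposition 3's frames).  REMAINING AS NAMED HYPOTHESES: `p5e`,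
`p5u` (Proposition 5 on a `LandauData` family — the same fixed point), `p6` (Proposition 6 on a `CubeData` family), `p7` (Proposition 7 —
needs the axial re-gauging `toAxial`), `t8` (Theorem 8 surviving — the Theorem-4 chain with sources).

WHAT IS PROVED (kernel, 0 sorry, theorems only): **`b8LeafRS_zd3_univ`** — `B8LeafRS d L C₂ (5dLB₀) B₀′ B₁ B₂ c₁ inp B₀β (blockPairNA d Lb 𝔸)
famUniv lan cub toAxial` from the five sockets and the five remaining conjuncts.

HONEST SCOPE.  A knit BY NAME; not a discharge of N05 (the family of record is not pinned; five conjuncts and five sockets remain); the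
prototype's declared readings (`B8LeafModelZd3` docstring) apply; count-neutral; nothing continuum / ℝ⁴ / OS / mass-gap / Clay.  Unit
`pub-ymgap-dag-n05-a` (g5), 2026-08-26.
-/

noncomputable section

namespace Literature.MathematicalPhysics.QuantumFieldTheory.Balaban1983to89.B8LeafKnitZd3

open B8LeafKnit (thm4Printed_precomp prop3Printed_precomp)
open B8LeafKnitRS (B8LeafRS)
open B8LeafModelZd (SockH59 SockP5u ZdIdx)
open B8LeafModelZdOfHFP (SockHFP₀ SockHFP)
open B8LeafModelZd3 (zdGF3 SockB9P3 thm4Printed_zd3_of_HFP₄ prop3Printed_zd3)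
open B8LeafModelZd3Thm2 (thm2Printed_zd3_univ)
open B8Lemma1NonAbelian (blockPairNA lemma1Printed_blockPairNA)

-- `Site` alone could resolve to the torus sites of `Setup.lean`; re-export the `ℤ^d` sites of `B7Prop1Explicit`.
export B7Prop1Explicit (Site)

variable {d : ℕ}

section Knit

variable {𝔸 : Type} [CStarAlgebra 𝔸] [Nontrivial 𝔸]
variable {I₃ I₄ : Type} {lan : I₃ → B8.LandauData} {cub : I₄ → B8.CubeData}

/-- **THE RE-TYPED B8 LEAF AT THE CONCRETE PROTOTYPE FAMILY, FOUR CONJUNCTS DISCHARGED**: for `d, L ≥ 2`, the leaf's `inp : B9Inputs` with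
`2 ≤ 5dL·inp.B₀`, `B₀β > 0`, `C₂ ≥ 2097152(d+1)²`, Prop. 5's radius `cu > 0`, any Hölder data `β, len`, any block size `Lb` for the Lemma-1
carriers, the member-wise sockets of Theorem 4 (`SockHFP₀`, `SockHFP`, `SockH59`, `SockP5u`) and of Proposition 3 (`SockB9P3`) below
their thresholds, and the five REMAINING printed statements as hypotheses (`p5e`, `p5u` on any `LandauData` family, `p6` on any `CubeData`
family, `p7` for any `toAxial`, `t8`): `B8LeafRS d L C₂ (5dL·inp.B₀) inp.B₀′ B₁ B₂ c₁ inp B₀β (blockPairNA d Lb 𝔸) famUniv lan cub toAxial`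
with `l1 := lemma1Printed_blockPairNA`, `t2 := thm2Printed_zd3_univ`, `p3 := prop3Printed_zd3`, `t4 := thm4Printed_zd3_of_HFP₄` (restricted
to the sub-family). [cite: Balaban1985RegularSpaces, Lemma 1 p.79, Thm 2 p.83, Prop. 3 p.87, Thm 4 p.88 (kernel instances); Prop. 5 p.94, Prop. 6 p.99, Prop. 7 p.100, Thm 8 p.101 (named hypotheses)] -/
theorem b8LeafRS_zd3_univ (hd2 : 2 ≤ d) {L : ℕ} (hL : 2 ≤ L) (Lb : ℕ) (β : ℝ) (len : Site d → ℝ) (inp : B8.B9Inputs)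
    {B₀β C₂ cu cF₀ cF c59 cu' cB9 B₁ B₂ c₁ : ℝ} (hB : 2 ≤ 5 * (d : ℝ) * L * inp.B₀) (hB₀β : 0 < B₀β)
    (hC₂ : 2097152 * ((d : ℝ) + 1) ^ 2 ≤ C₂) (hcu : 0 < cu) (hcF₀ : 0 < cF₀) (hcF : 0 < cF) (hc59 : 0 < c59) (hcu' : 0 < cu')
    (hcB9 : 0 < cB9)
    (SHFP₀ : ∀ i : ZdIdx d L, SockHFP₀ (𝔸 := 𝔸) L inp.B₀ inp.B₀' cF₀ i.η i.k i.Ω i.Λs)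
    (SHFP : ∀ i : ZdIdx d L, SockHFP (𝔸 := 𝔸) L inp.B₀ inp.B₀' cF i.η i.k i.Ω i.Λs)
    (SH59 : ∀ i : ZdIdx d L, SockH59 (𝔸 := 𝔸) L inp.B₀ inp.B₀' c59 i.η i.k i.Ω i.Λs i.Λb)
    (SP5u : ∀ i : ZdIdx d L, SockP5u (𝔸 := 𝔸) L cu' cu i.η i.k i.Ω i.Λs)
    (SB9 : ∀ i : ZdIdx d L, SockB9P3 (𝔸 := 𝔸) L inp.B₀ B₀β cB9 β len i.η i.k i.Ω i.Λs i.Λb)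
    {toAxial : ∀ i : {i : ZdIdx d L // i.Ω 0 = Set.univ}, (zdGF3 𝔸 L β len i.1).Cfg → (zdGF3 𝔸 L β len i.1).Pert →
      (zdGF3 𝔸 L β len i.1).Pert}
    (p5e : B8.Prop5Exists inp.B₀' B₁ lan) (p5u : B8.Prop5Unique lan) (p6 : B8.Prop6Printed d (L : ℝ) B₁ c₁ cub)
    (p7 : B8SectGH.Prop7PrintedR (fun i : {i : ZdIdx d L // i.Ω 0 = Set.univ} => zdGF3 𝔸 L β len i.1) toAxial)
    (t8 : B8Thm8Surviving.Thm8SurvivingAt 1 B₁ B₂ (fun i : {i : ZdIdx d L // i.Ω 0 = Set.univ} => zdGF3 𝔸 L β len i.1)) :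
    B8LeafRS d (L : ℝ) C₂ (5 * (d : ℝ) * L * inp.B₀) inp.B₀' B₁ B₂ c₁ inp B₀β (blockPairNA d Lb 𝔸)
      (fun i : {i : ZdIdx d L // i.Ω 0 = Set.univ} => zdGF3 𝔸 L β len i.1) lan cub toAxial where
  l1 := lemma1Printed_blockPairNA d Lb 𝔸
  t2 := thm2Printed_zd3_univ hd2 hL inp.B₀_pos inp.B₀'_pos hB₀β hB hcu hcF₀ hcF hc59 hcu' hcB9 SHFP₀ SHFP SH59 SP5u SB9
  p3 := prop3Printed_precomp (fun i : {i : ZdIdx d L // i.Ω 0 = Set.univ} => i.1) d (L : ℝ) C₂ inp B₀β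
    (fun i : ZdIdx d L => (zdGF3 𝔸 L β len i).toGFData2) (prop3Printed_zd3 hd2 hL inp hB₀β.le hC₂ hcB9 β len SB9)
  t4 := thm4Printed_precomp (fun i : {i : ZdIdx d L // i.Ω 0 = Set.univ} => i.1) (5 * (d : ℝ) * L * inp.B₀)
    (fun i : ZdIdx d L => (zdGF3 𝔸 L β len i).toGFData)
    (thm4Printed_zd3_of_HFP₄ hd2 hL inp.B₀_pos inp.B₀'_pos hB hcu hcF₀ hcF hc59 hcu' SHFP₀ SHFP SH59 SP5u)
  p5e := p5e
  p5u := p5u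
  p6 := p6
  p7 := p7
  t8 := t8

end Knit

#print axioms b8LeafRS_zd3_univ

end Literature.MathematicalPhysics.QuantumFieldTheory.Balaban1983to89.B8LeafKnitZd3

end
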